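import Summits.BirchSwinnertonDyer.BirchSwinnertonDyer.Theses.BiquadraticEisensteinDescent
import Summits.BirchSwinnertonDyer.Rank1Residual.WAll.AltClosersManinCells
import HarnessLib

/-!
# `BiquadraticEisensteinDescent.ManinDatumFiveSevenCMInertOfParts` holds (route BiquadraticEisensteinDescent,
# glue of the R57 split of the Manin residual `ManinDatumFiveSevenCMInert`; item stmt-BirchSwinnertonDyer-20114)

`ManinDatumFiveSevenCMInertOfParts : MazurManinOdd → AbbesUllmoManinGood → CesnaviciusManinTwo →
ModularityNewformExists → ManinDatumSupercuspidalCMInert → ManinDatumFiveSevenCMInert` — the four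
by-name `cite_only` children (Mazur 1978 Cor. 4.1, Abbes–Ullmo 1996, Česnavičius 2018 at `2 ∥ N`,
modularity as the existence of a newform, each VERBATIM a named Literature fact resp. its unfolding) and
the SUPERCUSPIDAL residual (`p = 5 ∧ j = 0 ∧` Kodaira II/IV/IV*/II*, or `p = 7 ∧ j = 1728 ∧` III/III*)
imply the parent. The proof is ONE LINE: the lane-2 alt-closer
`Summit.BirchSwinnertonDyer.Rank1Residual.WAll.maninDatumFiveSevenCMInert_of_facts_of_supercuspidalResidual`
(`WAll/AltClosersManinCells.lean`, p504165: the `Iₙ*` half of the parent is the tree theorem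
`ModularForms.not_dvd_maninConstant_of_kodairaSymbolAt_eq_Istar`, Stevens 1989 / Mazur), whose
hypotheses and conclusion are the children and the parent by `defeq` (planner bsd-wall-cm g2's split,
route rev 4 27deacbe0b68; evidence `ManinDatumFiveSevenCMInertOfParts_proof.lean` 40e9f65c28cfb063).
Statement PRINTED fully qualified. File with: `ledger propose --kind proof --target
Summits/BirchSwinnertonDyer/BirchSwinnertonDyer/Theorems/BiquadraticEisensteinDescentManinDatumFiveSevenCMInertOfParts.lean
--file <this> --workitem stmt-BirchSwinnertonDyer-20114`.
-/

set_option autoImplicit false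
set_option linter.dupNamespace false

namespace Summit.BirchSwinnertonDyer.BirchSwinnertonDyer.Theorems.BiquadraticEisensteinDescentManinDatumFiveSevenCMInertOfParts

/-- The R57 split glues back: Mazur + Abbes–Ullmo + Česnavičius + modularity + the supercuspidal
residual ⟹ `ManinDatumFiveSevenCMInert` (the `Iₙ*` cells are closed in the tree). [folklore] -/
theorem maninDatumFiveSevenCMInertOfParts_holds :
    Summit.BirchSwinnertonDyer.BirchSwinnertonDyer.Theses.BiquadraticEisensteinDescent.ManinDatumFiveSevenCMInertOfParts :=
  fun hM hAU hC2 hnf hRes ↦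
    Summit.BirchSwinnertonDyer.Rank1Residual.WAll.maninDatumFiveSevenCMInert_of_facts_of_supercuspidalResidual
      hM hAU hC2 hnf hRes

end Summit.BirchSwinnertonDyer.BirchSwinnertonDyer.Theorems.BiquadraticEisensteinDescentManinDatumFiveSevenCMInertOfParts
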